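import Summits.HubbardSuperconductivity.HubbardSuperconductivity.Theorems.AnisotropyChordTransferTheorem

/-!
# Route `AnisotropyChord` / H0 rotor rung, route (1): THEOREM T in the H0 chain's currency — «KLS anchor + symmetric z = 1 gap
# + (H3) + LEMMA E ⇒ BEC of hard-core bosons on `(ℤ/L)²` at `N = L²/2 + j` for every fixed `j ≤ k`»
(prover seat `hubbard-h0-rotor-p1` g13; theory seat `hubbard-h0-rotor-theory-1` THEOREM-T.md, memo ROTOR-THEORY-11 §175)

`condensateOnFirstSectors_of_hypotheses`: the theory seat's THEOREM T (`transferTheorem_holds`) composed with the COROLLARY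
(`firstLinksGiveCondensate_holds`), with (H4) and TRANSFER discharged by the tree (`perronTranslationInvariant_holds`,
`spinSquaredTransfer_holds`) and the two parity side conditions of the corollary PROVED here (`exists_perron_zero_of_even`: for even
`L` the sector `0` carries a Perron amplitude; `even_of_perron_nat`: a Perron amplitude in an integer sector forces `L` even).
Remaining hypotheses: (H1) `HalfFillingAnchor Δ c₀` (KLS; in the tree at `Δ = 0`), (H2) `SymmetricSectorGap Δ c₁ (k+1)` (conjecture),
(H3) `SectorZeroGlobalGround Δ`, LEMMA E `LadderExcessBound`.  Nothing here is a statement about the Hubbard model.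
-/

set_option linter.dupNamespace false
set_option autoImplicit false

noncomputable section

open Finset Filter Topology
open Literature.MathematicalPhysics.QuantumLattice Literature.Probability.LatticeModels
open Summit.HubbardSuperconductivity.HubbardSuperconductivity.Theorems.AnisotropyChord.InsertionEntropy
open Summit.HubbardSuperconductivity.HubbardSuperconductivity.Theorems.AnisotropyChord.Tower
open Summit.HubbardSuperconductivity.HubbardSuperconductivity.Theorems.AnisotropyChord

namespace Summit.HubbardSuperconductivity.HubbardSuperconductivity.Theorems.AnisotropyChord.Transfer

variable {L : ℕ} [NeZero L]

/-- for even `L` the half-filling sector `0` carries a Perron sector ground amplitude. [folklore] -/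
theorem exists_perron_zero_of_even (Δ : ℝ) (hL : Even L) :
    ∃ a₀ : TensorIndex (TorusSite 2 L) 2 → ℝ, IsPerronSectorGroundAmplitude L Δ 0 a₀ := by
  obtain ⟨m, hm⟩ := hL
  have hLm : L ^ 2 = 2 * (2 * m ^ 2) := by rw [hm]; ring
  obtain ⟨b, hb⟩ := exists_perron_of_weight (L := L) Δ (2 * m ^ 2) (by rw [hLm]; omega)
  have hcard : (Fintype.card (TorusSite 2 L) : ℝ) = (L : ℝ) ^ 2 := by
    rw [Fintype.card_fun, ZMod.card, Fintype.card_fin]; push_cast; ring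
  have e : (((Fintype.card (TorusSite 2 L) * 1 : ℕ) : ℝ) / 2 - ((2 * m ^ 2 : ℕ) : ℝ)) = 0 := by
    push_cast
    rw [hcard]
    have : ((L : ℝ)) ^ 2 = 2 * (2 * (m : ℝ) ^ 2) := by exact_mod_cast hLm
    rw [this]; ring
  rw [e] at hb
  exact ⟨b, hb⟩

/-- a Perron amplitude in an integer sector forces `L` to be even. [folklore] -/
theorem even_of_perron_nat {Δ : ℝ} {j : ℕ} {a : TensorIndex (TorusSite 2 L) 2 → ℝ}
    (ha : IsPerronSectorGroundAmplitude L Δ (j : ℝ) a) : Even L := by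
  obtain ⟨n, _, hn⟩ := perron_natSector ha
  have hcard : (Fintype.card (TorusSite 2 L) : ℝ) = ((L ^ 2 : ℕ) : ℝ) := by
    rw [Fintype.card_fun, ZMod.card, Fintype.card_fin]
  rw [hcard] at hn
  push_cast at hn
  have h2 : ((2 * n : ℕ) : ℝ) = ((L ^ 2 + 2 * j : ℕ) : ℝ) := by push_cast; linarith
  have h3 : 2 * n = L ^ 2 + 2 * j := by exact_mod_cast h2
  have h4 : Even (L ^ 2) := ⟨n - j, by omega⟩
  exact (Nat.even_pow' two_ne_zero).mp h4

/-- **THEOREM T in the H0 chain's currency.**  For `0 ≤ Δ < 1`, `c₀, c₁ > 0` and `k`:  (H1) KLS anchor + (H2) symmetric `z = 1`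
sector gap (Temple form, sectors `|j| ≤ k+1`) + (H3) the `Sᶻ = 0` sector is the global ground + LEMMA E (ladder excess bound)
⇒ `CondensateOnFirstSectors Δ k`: the Perron sector ground states of the XXZ torus in EACH of the sectors `j = 0, 1, …, k`
(hard-core bosons at `N = L²/2 + j`) condense eventually in `L` — BEC beyond the half-filled sector where Kennedy–Lieb–Shastry
applies, conditional on (H2), (H3), LEMMA E.  ((H4) and TRANSFER are discharged by the tree.)
[conjecture: theory seat hubbard-h0-rotor-theory-1, cycle 12, memo §175 — CONDITIONAL RUNG T; Lean proof of the implication here] -/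
theorem condensateOnFirstSectors_of_hypotheses {Δ c₀ c₁ : ℝ} {k : ℕ} (hΔ0 : 0 ≤ Δ) (hΔ1 : Δ < 1)
    (hc₀ : 0 < c₀) (hc₁ : 0 < c₁) (hA : HalfFillingAnchor Δ c₀) (hGap : SymmetricSectorGap Δ c₁ (k + 1))
    (hGlob : SectorZeroGlobalGround Δ) (hLE : LadderExcessBound) : CondensateOnFirstSectors Δ k := by
  have hlinks : FirstLinksUpTo Δ (c₀ / 2) k :=
    transferTheorem_holds Δ c₀ c₁ k hΔ0 hΔ1 hc₀ hc₁ hA hGap hGlob (perronTranslationInvariant_holds Δ) hLE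
      spinSquaredTransfer_holds (c₀ / 2) (by linarith)
  refine firstLinksGiveCondensate_holds Δ (c₀ / 2) c₀ k (by linarith) (by linarith) hA ?_ ?_ hlinks
  · exact Filter.Eventually.of_forall fun L _ hL => exists_perron_zero_of_even Δ hL
  · exact Filter.Eventually.of_forall fun L _ hL j a ha => hL (even_of_perron_nat ha)

end Summit.HubbardSuperconductivity.HubbardSuperconductivity.Theorems.AnisotropyChord.Transfer
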